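import Mathlib
import HarnessLib
import Summits.Ventures.LatticeQCDFlow.Exactness.FlowPushforward
import Summits.Ventures.LatticeQCDFlow.Exactness.U1MaskedLayerJacobian
import Summits.Ventures.LatticeQCDFlow.Scaling.EntropyBudgetCoupling

/-!
# Any degree-one `C¹` lift with positive derivative is a U(1) link map with exact Jacobian — the generic certificate behind every U(1) coupling layer (NTHMC / Wilson-flow class AND the NCP class)

HONEST FRAMING: exact (Metropolis-corrected) sampling algorithms for lattice gauge theory;
figures of merit are autocorrelation/cost numbers at stated couplings and volumes; no
continuum-physics claim.

Venture `LatticeQCDFlow` (cell pub-lqcd), topic `Exactness`; FANOUT row 14 (`eng-flowhmc`).  NEW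
WORK of the cell over Mathlib and the tree's `Exactness/FlowPushforward.lean` (`HasJacobian`),
`Exactness/U1MaskedLayerJacobian.lean` (row 14: measurability through representatives on
`AddCircle (2π)`), `Scaling/EntropyBudgetCoupling.lean` (row 31: `Theory2.coupleFun`,
`Theory2.hasJacobian_coupleFun`).  Nothing is cited as a fact.  Printed counterparts, named only:
Kanwar et al. 2020 (gauge-equivariant U(1) flows: the active link is moved by a mixture of
"non-compact projection" circle diffeomorphisms), Rezende et al. 2020 (flows on tori and spheres),
Jin 2022 / He–Jin–Osborn–Zhao 2025, Lüscher 2010.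

`U1MaskedLayerJacobian.lean` / `U1MaskedLayerCoupling.lean` certify the engine's plaquette-driven
layer map `θ ↦ θ + Σ_j c_j sin(α_j − θ)`.  The argument used nothing about sines: only that the
lift `Φ : ℝ → ℝ` is `C¹` with `Φ' > 0` and `Φ(θ + 2π) = Φ(θ) + 2π`.  This file records the
GENERIC statement, so that every U(1) coupling layer of the cell (rows 3 / 4: the NCP spline
flows of `latflow.flows_jax`; row 14: `u1-flow-trained` members inside HMC) is certified by
checking three calculus facts about its single-link lift.

## Content (for a lift `Φ` with derivative `Φ'`: `hderiv`, `hcont : Continuous Φ'`,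
`hpos : 0 < Φ'`, `hdeg : Φ (θ + 2π) = Φ θ + 2π`)

* `continuous_of_hasDerivAt'`, `periodic_deriv_of_degreeOne` (`Φ'` is `2π`-periodic),
  `integral_comp_degreeOne_period` — `∫_a^{a+2π} g(Φ θ) Φ'(θ) dθ = ∫_a^{a+2π} g` for continuous
  `2π`-periodic `g` (substitution + periodicity; no positivity needed);
* `exists_circle_lift_of_degreeOne` — `Φ` and `Φ'` DESCEND to the circle: there are
  `F : ℝ/2πℤ → ℝ/2πℤ`, `j : ℝ/2πℤ → ℝ` with `F ↑θ = ↑(Φ θ)`, `j ↑θ = Φ' θ`;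
* **`hasJacobian_circle_of_degreeOne`** — any such `F`, with `J ↑θ = ofReal (Φ' θ)`, satisfies
  `HasJacobian volume F J` (Haar measure of `AddCircle (2π)`): the single-link certificate;
* **`hasJacobian_coupleFun_of_degreeOne`** — a COUPLING LAYER on `ι → ℝ/2πℤ` (product Haar
  measure, any finite `ι`, any active predicate) whose active link `a` is moved, given the frozen
  links `y`, by a lift `Φ a y` as above, jointly measurable in `(θ, y)` together with its
  derivative, has `HasJacobian (Measure.pi fun _ => volume) (coupleFun p ψ) (ofReal ∘ coupleJac p jac)`
  with `jac a y ↑θ = Φ' a y θ` — row 31's `hasJacobian_coupleFun` with its per-link hypothesis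
  discharged by the previous item.

NOT here: the calculus facts for the NCP mixture itself (its lift is
`θ ↦ 2·atan(e^s tan(θ/2))` glued across `θ = π`; rows 3 / 4), SU(N), autocorrelations.
-/

noncomputable section

namespace Summit.Ventures.LatticeQCDFlow.Exactness

open Real Set Function MeasureTheory Summit.Ventures.LatticeQCDFlow.Theory2
open scoped NNReal ENNReal

section DegreeOne

variable {Φ Φ' : ℝ → ℝ}

/-- A function with a derivative everywhere is continuous. -/
theorem continuous_of_hasDerivAt' (hderiv : ∀ θ, HasDerivAt Φ (Φ' θ) θ) : Continuous Φ :=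
  continuous_iff_continuousAt.2 fun θ => (hderiv θ).continuousAt

/-- The derivative of a degree-one lift is `2π`-periodic. -/
theorem periodic_deriv_of_degreeOne (hderiv : ∀ θ, HasDerivAt Φ (Φ' θ) θ)
    (hdeg : ∀ θ, Φ (θ + 2 * π) = Φ θ + 2 * π) : Function.Periodic Φ' (2 * π) := by
  intro θ
  have h1 : HasDerivAt (fun x => Φ (x + 2 * π)) (Φ' (θ + 2 * π)) θ :=
    (hderiv (θ + 2 * π)).comp_add_const θ (2 * π)
  have h2 : HasDerivAt (fun x => Φ (x + 2 * π)) (Φ' θ) θ := by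
    have h := (hderiv θ).add_const (2 * π)
    refine h.congr_of_eventuallyEq (Filter.Eventually.of_forall fun x => ?_)
    exact hdeg x
  exact h1.unique h2

/-- **Substitution on a period**: for a degree-one lift `Φ` with continuous derivative `Φ'` and a
continuous `2π`-periodic `g`, `∫_a^{a+2π} g(Φ θ) Φ'(θ) dθ = ∫_a^{a+2π} g`. -/
theorem integral_comp_degreeOne_period (hderiv : ∀ θ, HasDerivAt Φ (Φ' θ) θ)
    (hcont : Continuous Φ') (hdeg : ∀ θ, Φ (θ + 2 * π) = Φ θ + 2 * π) (a : ℝ) {g : ℝ → ℝ}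
    (hg : Continuous g) (hper : Function.Periodic g (2 * π)) :
    ∫ θ in a..a + 2 * π, g (Φ θ) * Φ' θ = ∫ θ in a..a + 2 * π, g θ := by
  have h1 := intervalIntegral.integral_comp_mul_deriv (a := a) (b := a + 2 * π)
    (fun θ _ => hderiv θ) hcont.continuousOn hg
  rw [hdeg a, hper.intervalIntegral_add_eq _ a] at h1
  simpa only [Function.comp_apply] using h1

/-- **Non-vacuity**: a degree-one lift and its derivative descend to the circle. -/
theorem exists_circle_lift_of_degreeOne (hderiv : ∀ θ, HasDerivAt Φ (Φ' θ) θ)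
    (hdeg : ∀ θ, Φ (θ + 2 * π) = Φ θ + 2 * π) :
    ∃ (F : AddCircle (2 * π) → AddCircle (2 * π)) (j : AddCircle (2 * π) → ℝ),
      (∀ θ : ℝ, F θ = ((Φ θ : ℝ) : AddCircle (2 * π))) ∧ (∀ θ : ℝ, j θ = Φ' θ) := by
  have hF : Function.Periodic (fun θ : ℝ => ((Φ θ : ℝ) : AddCircle (2 * π))) (2 * π) := by
    intro θ
    simp only
    rw [hdeg θ, AddCircle.coe_add_period]
  have hj : Function.Periodic Φ' (2 * π) := periodic_deriv_of_degreeOne hderiv hdeg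
  exact ⟨hF.lift, hj.lift, fun θ => hF.lift_coe θ, fun θ => hj.lift_coe θ⟩

variable [hT : Fact (0 < 2 * π)]

/-- **The generic single-link certificate.**  A `C¹` degree-one lift `Φ` with positive derivative
`Φ'` defines a map of the circle `ℝ/2πℤ` with Jacobian `Φ'` for the Haar measure: any `F`, `J`
with `F ↑θ = ↑(Φ θ)`, `J ↑θ = ofReal (Φ' θ)` satisfy `HasJacobian volume F J`. -/
theorem hasJacobian_circle_of_degreeOne (hderiv : ∀ θ, HasDerivAt Φ (Φ' θ) θ)
    (hcont : Continuous Φ') (hpos : ∀ θ, 0 < Φ' θ) (hdeg : ∀ θ, Φ (θ + 2 * π) = Φ θ + 2 * π)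
    {F : AddCircle (2 * π) → AddCircle (2 * π)}
    (hF : ∀ θ : ℝ, F θ = ((Φ θ : ℝ) : AddCircle (2 * π)))
    {J : AddCircle (2 * π) → ℝ≥0∞} (hJ : ∀ θ : ℝ, J θ = ENNReal.ofReal (Φ' θ)) :
    HasJacobian (volume : Measure (AddCircle (2 * π))) F J := by
  have hΦc : Continuous Φ := continuous_of_hasDerivAt' hderiv
  have hFm : Measurable F := AddCircle.measurable_of_measurable_comp_coe (by
    simp_rw [hF]; exact AddCircle.measurable_mk'.comp hΦc.measurable)
  have hJm : Measurable J := AddCircle.measurable_of_measurable_comp_coe (by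
    simp_rw [hJ]; exact ENNReal.measurable_ofReal.comp hcont.measurable)
  refine ⟨hFm, hJm, ?_⟩
  refine (ext_of_forall_lintegral_eq_of_IsFiniteMeasure fun f => ?_).symm
  have hfm : Measurable fun x : AddCircle (2 * π) => (f x : ℝ≥0∞) :=
    measurable_coe_nnreal_ennreal.comp f.continuous.measurable
  have hfFm : Measurable fun a : AddCircle (2 * π) => (f (F a) : ℝ≥0∞) := hfm.comp hFm
  rw [lintegral_map hfm hFm, lintegral_withDensity_eq_lintegral_mul _ hJm hfFm,
    ← AddCircle.lintegral_preimage (2 * π) 0, ← AddCircle.lintegral_preimage (2 * π) 0]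
  simp only [Pi.mul_apply, hF, hJ, zero_add]
  set g : ℝ → ℝ := fun θ => (f (θ : AddCircle (2 * π)) : ℝ) with hg
  have hgc : Continuous g :=
    NNReal.continuous_coe.comp (f.continuous.comp (AddCircle.continuous_mk' (2 * π)))
  have hgp : Function.Periodic g (2 * π) := fun θ => by
    simp only [hg]
    rw [AddCircle.coe_add_period]
  have hg0 : ∀ θ, 0 ≤ g θ := fun θ => NNReal.coe_nonneg _
  have hcoe : ∀ θ : ℝ, ((f (θ : AddCircle (2 * π)) : ℝ≥0) : ℝ≥0∞) = ENNReal.ofReal (g θ) :=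
    fun θ => ENNReal.ofReal_coe_nnreal.symm
  have h2π : (0 : ℝ) ≤ 2 * π := by positivity
  have lhs : ∫⁻ θ in Ioc (0 : ℝ) (2 * π), ((f (θ : AddCircle (2 * π)) : ℝ≥0) : ℝ≥0∞) =
      ENNReal.ofReal (∫ θ in (0 : ℝ)..2 * π, g θ) := by
    simp_rw [hcoe]
    rw [intervalIntegral.integral_of_le h2π,
      ofReal_integral_eq_lintegral_ofReal hgc.integrableOn_Ioc (ae_of_all _ hg0)]
  have hprod : Continuous fun θ : ℝ => Φ' θ * g (Φ θ) := hcont.mul (hgc.comp hΦc)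
  have rhs : ∫⁻ θ in Ioc (0 : ℝ) (2 * π), ENNReal.ofReal (Φ' θ) *
        ((f ((Φ θ : ℝ) : AddCircle (2 * π)) : ℝ≥0) : ℝ≥0∞) =
      ENNReal.ofReal (∫ θ in (0 : ℝ)..2 * π, Φ' θ * g (Φ θ)) := by
    have hpt : ∀ θ : ℝ, ENNReal.ofReal (Φ' θ) * ((f ((Φ θ : ℝ) : AddCircle (2 * π)) : ℝ≥0) : ℝ≥0∞)
        = ENNReal.ofReal (Φ' θ * g (Φ θ)) := by
      intro θ
      rw [hcoe, ← ENNReal.ofReal_mul (hpos θ).le]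
    simp_rw [hpt]
    rw [intervalIntegral.integral_of_le h2π, ofReal_integral_eq_lintegral_ofReal
      hprod.integrableOn_Ioc (ae_of_all _ fun θ => mul_nonneg (hpos θ).le (hg0 _))]
  rw [lhs, rhs]
  congr 1
  have h := integral_comp_degreeOne_period hderiv hcont hdeg 0 hgc hgp
  rw [zero_add] at h
  rw [← h]
  exact intervalIntegral.integral_congr fun θ _ => mul_comm _ _

end DegreeOne

/-! ## Coupling layers built from degree-one lifts -/

section Coupling

variable [hT : Fact (0 < 2 * π)] {ι : Type*} [Fintype ι] {p : ι → Prop} [DecidablePred p]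

/-- **Coupling layers from degree-one lifts are exact.**  On `ι → ℝ/2πℤ` with product Haar
measure, a coupling layer (`Theory2.coupleFun p ψ`) whose active link `a` is moved, given the
frozen links `y`, by a lift `Φ a y` that is `C¹` with positive derivative `Φ' a y` and degree one,
with `(θ, y) ↦ Φ a y θ` and `(θ, y) ↦ Φ' a y θ` jointly measurable, and with `ψ`, `jac` given on
representatives by `ψ a y ↑θ = ↑(Φ a y θ)`, `jac a y ↑θ = Φ' a y θ`, satisfies
`HasJacobian (Measure.pi fun _ => volume) (coupleFun p ψ) (ofReal ∘ coupleJac p jac)`. -/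
theorem hasJacobian_coupleFun_of_degreeOne
    {Φ Φ' : {i // p i} → ({i // ¬p i} → AddCircle (2 * π)) → ℝ → ℝ}
    (hderiv : ∀ a y θ, HasDerivAt (Φ a y) (Φ' a y θ) θ) (hcont : ∀ a y, Continuous (Φ' a y))
    (hpos : ∀ a y θ, 0 < Φ' a y θ) (hdeg : ∀ a y θ, Φ a y (θ + 2 * π) = Φ a y θ + 2 * π)
    (hΦm : ∀ a, Measurable fun w : ℝ × ({i // ¬p i} → AddCircle (2 * π)) => Φ a w.2 w.1)
    (hΦ'm : ∀ a, Measurable fun w : ℝ × ({i // ¬p i} → AddCircle (2 * π)) => Φ' a w.2 w.1)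
    {ψ : {i // p i} → ({i // ¬p i} → AddCircle (2 * π)) → AddCircle (2 * π) → AddCircle (2 * π)}
    (hψ : ∀ a y (θ : ℝ), ψ a y θ = ((Φ a y θ : ℝ) : AddCircle (2 * π)))
    {jac : {i // p i} → ({i // ¬p i} → AddCircle (2 * π)) → AddCircle (2 * π) → ℝ}
    (hjac : ∀ a y (θ : ℝ), jac a y θ = Φ' a y θ) :
    HasJacobian (Measure.pi fun _ : ι => (volume : Measure (AddCircle (2 * π))))
      (coupleFun p ψ) fun U => ENNReal.ofReal (coupleJac p jac U) := by
  have hψm : ∀ a, Measurable fun q : AddCircle (2 * π) × ({i // ¬p i} → AddCircle (2 * π)) =>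
      ψ a q.2 q.1 := fun a => by
    refine AddCircle.measurable_of_measurable_comp_coe_prod ?_
    simp_rw [hψ]
    exact AddCircle.measurable_mk'.comp (hΦm a)
  have hjm : ∀ a, Measurable fun q : AddCircle (2 * π) × ({i // ¬p i} → AddCircle (2 * π)) =>
      jac a q.2 q.1 := fun a => by
    refine AddCircle.measurable_of_measurable_comp_coe_prod ?_
    simp_rw [hjac]
    exact hΦ'm a
  have hj0 : ∀ a y g, 0 ≤ jac a y g := fun a y g => by
    obtain ⟨θ, rfl⟩ := QuotientAddGroup.mk_surjective g
    have h : jac a y (θ : AddCircle (2 * π)) = Φ' a y θ := hjac a y θ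
    exact (h ▸ (hpos a y θ).le : 0 ≤ jac a y (θ : AddCircle (2 * π)))
  refine hasJacobian_coupleFun volume hψm hjm (fun a y => ?_) hj0
  exact hasJacobian_circle_of_degreeOne (hderiv a y) (hcont a y) (hpos a y) (hdeg a y) (hψ a y)
    fun θ => by simp only [hjac]

end Coupling

end Summit.Ventures.LatticeQCDFlow.Exactness
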